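import Literature.AlgebraicGeometry.HodgeTheory.StabilizerScalarOfJetStabilizer
import Summits.HodgeConjecture.HodgeConjecture.Theorems.Q8SymplecticPowersTranscendentalIrreducibleOfFlatSpan
import Summits.HodgeConjecture.HodgeConjecture.Theorems.Q8SymplecticPowersTranscendentalPartOfMember
import HarnessLib

/-!
# Route `Q8SymplecticPowers`, crux K1Q (stmt-HodgeConjecture-24190): the S4 conjuncts at a member from the
# STABILISER criterion (uniform in `e`)

Prover seat `hodge-nonav-20241-p1` (g22); helper `--supports stmt-HodgeConjecture-24190` (closes no registered
stub). Companion of `Q8SymplecticPowersTranscendentalIrreducibleOfFlatSpan`: there the irreducibility of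
`M := ker(τ_s^* ⊗ ℂ − i)` under every finite-index monodromy subgroup came from the rank-one flat-span condition
(FS)_s, which needs `dim(M ∩ H^{2,0}) ≤ 1` — true only at `e = 4` (`dim = e(e−2)/8`, lit §173). Here it comes from
the planner's (C33) STAB condition (tree theorem `eq_bot_or_eq_of_stable_of_stabilizer_scalar`,
`Literature/…/SubvariationIrreducibleOfStabilizer`): «every endomorphism of `ℂ ⊗ H²(X_s; ℚ)` preserving `M` and
all the pulled-back `M ∩ F²(X_t)` (every member `t`, every path class, rational transport) is a scalar on `M`» —
no Hodge-number restriction, so the same chain serves every even `e ≥ 4`.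

* `transcendentalQuaternionicPart_at_member_of_irreducible` — the purely algebraic half, factored out: in the
  verbatim `let`-currency of the registered S4, from FACT-free hypotheses `A⁴ = 1`, (o)_s, (o′)_s, `6 ≤ dim M` and
  «`M` is irreducible under every finite-index `Γ' ≤ Γ_s`» follow all six S4 conjuncts at `s`
  ((iv) by `span_finiteIndexFixed_le_eigenspace_sq_one_of_irreducible`; `Mv = ker(A²+1)`, `Miv = M` by the
  `A`-isometry of `Qf`; (i) from (iv) + (o); (ii) from `Miv = M`).
* `transcendentalQuaternionicPart_at_member_of_stabilizer_scalar` — FACT B + (STAB)_s for `M` + the same counts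
  ⇒ the six conjuncts at `s`.
* `transcendentalQuaternionicPart_at_member_of_jetStabilizer` — the same from the finite JET-STABILISER certificate
  (`stabilizer_scalar_of_jetStabilizer`, `Literature/…/StabilizerScalarOfJetStabilizer`): data (ψ, W₀, ω, η, r).
* `transcendentalQuaternionicPart_forall_of_stabilizer_scalar` / `…_forall_of_jetStabilizer` — family-level forms for
  the ∃-packaged stub of skeleton v9/v10: the S4 body at EVERY member of ONE family from the data at ONE member
  (via 19716-p2's (B′) `transcendentalQuaternionicPart_forall_of_member_at`).

HONEST FRAMING: conditional helpers ((STAB)_s, FACT B and the counts are hypotheses); the ∀-family stub S4 of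
skeletons v6–v8 is known to be false as stated (planner finding 2026-08-29 15:22Z) and is replaced by the
∃-packaged S9 of v9, whose S4-half for a CHOSEN family these member theorems serve; S9 ∕ K1Q ∕ HC NOT proved.
-/

noncomputable section

set_option linter.dupNamespace false

namespace Summit.HodgeConjecture.HodgeConjecture.Theorems.Q8SymplecticPowersTranscendentalIrreducibleOfStabilizer

open CategoryTheory CategoryTheory.Limits AlgebraicGeometry
open scoped TensorProduct
open Literature.AlgebraicTopology.SingularHomology
open Literature.AlgebraicGeometry.Motives Literature.AlgebraicGeometry.HodgeTheory
open Literature.AlgebraicGeometry.HodgeTheory.BettiUniverse Literature.AlgebraicGeometry.HodgeTheory.Q8Family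
open Summit.HodgeConjecture.HodgeConjecture.Theorems.Q8SymplecticPowersTransportRestriction
open Summit.HodgeConjecture.HodgeConjecture.Theorems.Q8SymplecticPowersFiniteOrbitInvariantOfIrreducible
open Summit.HodgeConjecture.HodgeConjecture.Theorems.Q8SymplecticPowersTranscendentalIrreducibleOfFlatSpan

variable {𝒳 S : SchemeOver ℂ}

/-- **The six S4 conjuncts at a member from the irreducibility of `M = ker(A_ℂ − i)`** (pure algebra over the
deck relation and the counts; verbatim S4 `let`-currency): `A⁴ = 1` → (o)_s → (o′)_s → `6 ≤ dim M` →
«every finite-index `Γ' ≤ Γ_s` acts irreducibly on `M`» → `(o) ∧ (o′) ∧ (i) ∧ (ii) ∧ ((iii)) ∧ (iv)`.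
[cite: Deligne1987, §1.12 (p. 10)] [cite: VoisinHodgeI2002, §7.1.2] -/
theorem transcendentalQuaternionicPart_at_member_of_irreducible
    (π : 𝒳 ⟶ S) (hπ : IsSmoothProjectiveFamily π 2)
    (hU : IsCohomologicallyLocallyTrivialOn π (Set.univ : Set (ComplexPoints S)))
    (τ : 𝒳 ⟶ 𝒳) (hτπ : τ ≫ π = π) (s : ComplexPoints S) :
    let Xs := fiberOver π s
    let hXs : IsSmoothProjective 2 Xs := hπ.isSmoothProjective s
    let A : bettiCohomology Xs 2 →ₗ[ℚ] bettiCohomology Xs 2 := pull (fiberOverEnd π τ hτπ s) 2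
    let Qf : LinearMap.BilinForm ℚ (bettiCohomology Xs 2) := LinearMap.compr₂ (cup Xs 2 2) (tr hXs (2 + 2))
    let Γ := ratMonodromyGroup π 2 hU ⟨s, Set.mem_univ s⟩
    let N : Submodule ℚ (bettiCohomology Xs 2) := Submodule.span ℚ {x | ∃ Γ' : Subgroup
      (bettiCohomology Xs 2 ≃ₗ[ℚ] bettiCohomology Xs 2), Γ' ≤ Γ ∧ (Γ'.subgroupOf Γ).FiniteIndex ∧
        ∀ γ ∈ Γ', γ x = x}
    let Mv : Submodule ℚ (bettiCohomology Xs 2) := Module.End.eigenspace (A ^ 2) (-1) ⊓ Qf.orthogonal N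
    let Miv : Submodule ℂ (TensorProduct ℚ ℂ (bettiCohomology Xs 2)) :=
      Mv.baseChange ℂ ⊓ Module.End.eigenspace (A.baseChange ℂ) Complex.I
    let M : Submodule ℂ (TensorProduct ℚ ℂ (bettiCohomology Xs 2)) :=
      Module.End.eigenspace (A.baseChange ℂ) Complex.I
    A ^ 4 = 1 →
    Module.finrank ℂ ↥(Module.End.eigenspace ((A ^ 2).baseChange ℂ) 1 ⊓
      (hodge exists_isReal_hodgeModel_holds hXs 2).piece 2 0) = 0 →
    0 < Module.finrank ℂ ↥(Module.End.eigenspace ((A ^ 2).baseChange ℂ) (-1) ⊓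
      (hodge exists_isReal_hodgeModel_holds hXs 2).piece 2 0) →
    6 ≤ Module.finrank ℂ ↥M →
    (∀ Γ' : Subgroup (bettiCohomology Xs 2 ≃ₗ[ℚ] bettiCohomology Xs 2), Γ' ≤ Γ →
      (Γ'.subgroupOf Γ).FiniteIndex → ∀ F : Submodule ℂ (TensorProduct ℚ ℂ (bettiCohomology Xs 2)),
        F ≤ M → (∀ γ ∈ Γ', ∀ x ∈ F, (γ.toLinearMap.baseChange ℂ) x ∈ F) → F = ⊥ ∨ F = M) →
    Module.finrank ℂ ↥(Module.End.eigenspace ((A ^ 2).baseChange ℂ) 1 ⊓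
        (hodge exists_isReal_hodgeModel_holds hXs 2).piece 2 0) = 0 ∧
      0 < Module.finrank ℂ ↥(Module.End.eigenspace ((A ^ 2).baseChange ℂ) (-1) ⊓
        (hodge exists_isReal_hodgeModel_holds hXs 2).piece 2 0) ∧
      (N.baseChange ℂ ⊓ (hodge exists_isReal_hodgeModel_holds hXs 2).piece 2 0 = ⊥) ∧
      6 ≤ Module.finrank ℂ ↥Miv ∧
      (∀ Γ' : Subgroup (bettiCohomology Xs 2 ≃ₗ[ℚ] bettiCohomology Xs 2), Γ' ≤ Γ →
        (Γ'.subgroupOf Γ).FiniteIndex → ∀ F : Submodule ℂ (TensorProduct ℚ ℂ (bettiCohomology Xs 2)),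
          F ≤ Miv → (∀ γ ∈ Γ', ∀ x ∈ F, (γ.toLinearMap.baseChange ℂ) x ∈ F) → F = ⊥ ∨ F = Miv) ∧
      N ≤ Module.End.eigenspace (A ^ 2) 1 := by
  intro Xs hXs A Qf Γ N Mv Miv M hA4 ho ho' h6 hirr
  classical
  haveI hfin : ∀ t : ComplexPoints S, Module.Finite ℚ (bettiCohomology (fiberOver π t) 2) :=
    fun t ↦ finite (hπ.isSmoothProjective t) 2
  have h2 : 2 ≤ Module.finrank ℂ ↥M := le_trans (by norm_num) h6
  -- G1: `A` commutes with `Γ`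
  have hAΓ : ∀ γ ∈ Γ, ∀ x, γ (A x) = A (γ x) := fun γ hγ x ↦
    Q8SymplecticPowersMonodromyDeckCommutes.apply_pull_fiberOverEnd_of_mem_ratMonodromyGroup π 2 hU τ hτπ s hγ x
  -- (iv)
  have hiv : N ≤ Module.End.eigenspace (A ^ 2) 1 :=
    span_finiteIndexFixed_le_eigenspace_sq_one_of_irreducible Γ A hA4 hAΓ h2 hirr
  -- (i) from (iv) + (o)
  have hi : N.baseChange ℂ ⊓ (hodge exists_isReal_hodgeModel_holds hXs 2).piece 2 0 = ⊥ := by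
    have hle : N.baseChange ℂ ⊓ (hodge exists_isReal_hodgeModel_holds hXs 2).piece 2 0 ≤
        Module.End.eigenspace ((A ^ 2).baseChange ℂ) 1 ⊓ (hodge exists_isReal_hodgeModel_holds hXs 2).piece 2 0 := by
      refine inf_le_inf_right _ fun x hx ↦ ?_
      have hx' := Submodule.baseChange_mono ℂ hiv hx
      rw [mem_baseChange_eigenspace_iff] at hx'
      rw [Module.End.mem_eigenspace_iff, hx', Rat.cast_one]
    have h0 : Module.End.eigenspace ((A ^ 2).baseChange ℂ) 1 ⊓
        (hodge exists_isReal_hodgeModel_holds hXs 2).piece 2 0 = ⊥ := Submodule.finrank_eq_zero.1 ho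
    exact le_bot_iff.1 (h0 ▸ hle)
  -- `Mv = ker(A² + 1)` and `Miv = M` ((iv) + the `A`-isometry of `Qf`)
  have hpg : (hodge exists_isReal_hodgeModel_holds hXs 2).piece 2 0 ≠ ⊥ := by
    intro h0
    rw [h0, inf_bot_eq, finrank_bot] at ho'
    exact lt_irrefl 0 ho'
  have hAQ : ∀ x y, Qf (A x) (A y) = Qf x y := fun x y ↦
    Q8SymplecticPowersDeckIsometry.tr_cup_pull_pull_of_pull_pow_eq_one hXs (fiberOverEnd π τ hτπ s)
      (by norm_num : 0 < 4) hA4 hpg x y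
  have hA2 : ∀ x, (A ^ 2) x = A (A x) := fun x ↦ by rw [pow_two, Module.End.mul_apply]
  have hMv_eq : Mv = Module.End.eigenspace (A ^ 2) (-1) := by
    refine le_antisymm inf_le_left (le_inf le_rfl fun x hx ↦ ?_)
    rw [LinearMap.BilinForm.mem_orthogonal_iff]
    intro n hn
    have hn1 : (A ^ 2) n = n := by simpa only [one_smul] using Module.End.mem_eigenspace_iff.1 (hiv hn)
    have hx1 : (A ^ 2) x = -x := by simpa only [neg_one_smul] using Module.End.mem_eigenspace_iff.1 hx
    have hQ : Qf n x = Qf ((A ^ 2) n) ((A ^ 2) x) := by rw [hA2, hA2, hAQ, hAQ]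
    rw [hn1, hx1, map_neg] at hQ
    change Qf n x = 0
    linarith
  have hMiv_eq : Miv = M := by
    change Mv.baseChange ℂ ⊓ M = M
    refine inf_eq_right.2 fun x hx ↦ ?_
    rw [hMv_eq, mem_baseChange_eigenspace_iff]
    have hx' := Module.End.mem_eigenspace_iff.1 hx
    rw [LinearMap.baseChange_pow, pow_two, Module.End.mul_apply, hx', map_smul, hx', smul_smul,
      Complex.I_mul_I]
    push_cast
    ring_nf
  have hii : 6 ≤ Module.finrank ℂ ↥Miv := by rw [hMiv_eq]; exact h6
  refine ⟨ho, ho', hi, hii, fun Γ' hΓ' hfi F hF hFs ↦ ?_, hiv⟩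
  rw [hMiv_eq] at hF ⊢
  exact hirr Γ' hΓ' hfi F hF hFs

/-- **The six S4 conjuncts at a member from the STABILISER condition** (uniform in `e`; verbatim S4
`let`-currency): FACT B → `A⁴ = 1` → (o)_s → (o′)_s → `6 ≤ dim M` → (STAB)_s for `M = ker(A_ℂ − i)` →
`(o) ∧ (o′) ∧ (i) ∧ (ii) ∧ ((iii)) ∧ (iv)`. The irreducibility of `M` under every finite-index `Γ'` is
`eq_bot_or_eq_of_stable_of_stabilizer_scalar` (`M` is `Γ`-stable by G1 and `β_s M` is the `i`-eigenspace of the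
flat type-preserving field `τ_t^*`, a sub-variation); the rest is `…_at_member_of_irreducible`.
[cite: Deligne1987, §1.12–1.13 (p. 10–11)] [cite: VoisinHodgeI2002, §7.1.1] -/
theorem transcendentalQuaternionicPart_at_member_of_stabilizer_scalar
    (hDelB : deligne1987_monodromy_directSum_irreducible_subvariations)
    (π : 𝒳 ⟶ S) (d : ℕ) (hπ : IsSmoothProjectiveFamily π 2) (hS : IsQuasiProjectiveOver S)
    [AlgebraicGeometry.SmoothOfRelativeDimension d S.hom]
    (hU : IsCohomologicallyLocallyTrivialOn π (Set.univ : Set (ComplexPoints S)))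
    (τ : 𝒳 ⟶ 𝒳) (hτπ : τ ≫ π = π) (s : ComplexPoints S) :
    let Xs := fiberOver π s
    let hXs : IsSmoothProjective 2 Xs := hπ.isSmoothProjective s
    let A : bettiCohomology Xs 2 →ₗ[ℚ] bettiCohomology Xs 2 := pull (fiberOverEnd π τ hτπ s) 2
    let Qf : LinearMap.BilinForm ℚ (bettiCohomology Xs 2) := LinearMap.compr₂ (cup Xs 2 2) (tr hXs (2 + 2))
    let Γ := ratMonodromyGroup π 2 hU ⟨s, Set.mem_univ s⟩
    let N : Submodule ℚ (bettiCohomology Xs 2) := Submodule.span ℚ {x | ∃ Γ' : Subgroup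
      (bettiCohomology Xs 2 ≃ₗ[ℚ] bettiCohomology Xs 2), Γ' ≤ Γ ∧ (Γ'.subgroupOf Γ).FiniteIndex ∧
        ∀ γ ∈ Γ', γ x = x}
    let Mv : Submodule ℚ (bettiCohomology Xs 2) := Module.End.eigenspace (A ^ 2) (-1) ⊓ Qf.orthogonal N
    let Miv : Submodule ℂ (TensorProduct ℚ ℂ (bettiCohomology Xs 2)) :=
      Mv.baseChange ℂ ⊓ Module.End.eigenspace (A.baseChange ℂ) Complex.I
    let M : Submodule ℂ (TensorProduct ℚ ℂ (bettiCohomology Xs 2)) :=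
      Module.End.eigenspace (A.baseChange ℂ) Complex.I
    A ^ 4 = 1 →
    Module.finrank ℂ ↥(Module.End.eigenspace ((A ^ 2).baseChange ℂ) 1 ⊓
      (hodge exists_isReal_hodgeModel_holds hXs 2).piece 2 0) = 0 →
    0 < Module.finrank ℂ ↥(Module.End.eigenspace ((A ^ 2).baseChange ℂ) (-1) ⊓
      (hodge exists_isReal_hodgeModel_holds hXs 2).piece 2 0) →
    6 ≤ Module.finrank ℂ ↥M →
    (∀ φ : (TensorProduct ℚ ℂ (bettiCohomology Xs 2)) →ₗ[ℂ] (TensorProduct ℚ ℂ (bettiCohomology Xs 2)),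
      (∀ x ∈ M, φ x ∈ M) →
      (∀ (t : (Set.univ : Set (ComplexPoints S)))
        (γ : Path.Homotopic.Quotient (⟨s, Set.mem_univ s⟩ : (Set.univ : Set (ComplexPoints S))) t)
        (T : bettiCohomology Xs 2 ≃ₗ[ℚ] bettiCohomology (fiberOver π t.1) 2),
        (∀ v, ofRatClass _ 2 (T v) = transportFun π 2 hU γ (ofRatClass _ 2 v)) →
        ∀ x ∈ M ⊓ ((hodge exists_isReal_hodgeModel_holds (hπ.isSmoothProjective t.1) 2).comapEquiv T).F 2,
          φ x ∈ ((hodge exists_isReal_hodgeModel_holds (hπ.isSmoothProjective t.1) 2).comapEquiv T).F 2) →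
      ∃ c : ℂ, ∀ x ∈ M, φ x = c • x) →
    Module.finrank ℂ ↥(Module.End.eigenspace ((A ^ 2).baseChange ℂ) 1 ⊓
        (hodge exists_isReal_hodgeModel_holds hXs 2).piece 2 0) = 0 ∧
      0 < Module.finrank ℂ ↥(Module.End.eigenspace ((A ^ 2).baseChange ℂ) (-1) ⊓
        (hodge exists_isReal_hodgeModel_holds hXs 2).piece 2 0) ∧
      (N.baseChange ℂ ⊓ (hodge exists_isReal_hodgeModel_holds hXs 2).piece 2 0 = ⊥) ∧
      6 ≤ Module.finrank ℂ ↥Miv ∧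
      (∀ Γ' : Subgroup (bettiCohomology Xs 2 ≃ₗ[ℚ] bettiCohomology Xs 2), Γ' ≤ Γ →
        (Γ'.subgroupOf Γ).FiniteIndex → ∀ F : Submodule ℂ (TensorProduct ℚ ℂ (bettiCohomology Xs 2)),
          F ≤ Miv → (∀ γ ∈ Γ', ∀ x ∈ F, (γ.toLinearMap.baseChange ℂ) x ∈ F) → F = ⊥ ∨ F = Miv) ∧
      N ≤ Module.End.eigenspace (A ^ 2) 1 := by
  intro Xs hXs A Qf Γ N Mv Miv M hA4 ho ho' h6 hSTAB
  classical
  haveI hfin : ∀ t : ComplexPoints S, Module.Finite ℚ (bettiCohomology (fiberOver π t) 2) :=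
    fun t ↦ finite (hπ.isSmoothProjective t) 2
  let Am : ∀ t : ComplexPoints S, HodgeModel 2 (fiberOver π t) := fun t ↦
    realHodgeModel exists_isReal_hodgeModel_holds (hπ.isSmoothProjective t)
  have hAm : ∀ t, (Am t).IsHodgeSymmetric := fun t ↦
    realHodgeModel_isHodgeSymmetric exists_isReal_hodgeModel_holds (hπ.isSmoothProjective t)
  let e := ofRatClassBaseChangeEquiv hXs 2
  -- G1: `A` commutes with `Γ`; `M` is `Γ`-stable
  have hAΓ : ∀ γ ∈ Γ, ∀ x, γ (A x) = A (γ x) := fun γ hγ x ↦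
    Q8SymplecticPowersMonodromyDeckCommutes.apply_pull_fiberOverEnd_of_mem_ratMonodromyGroup π 2 hU τ hτπ s hγ x
  have hM_def : M = Module.End.eigenspace (A.baseChange ℂ) Complex.I := rfl
  have hMstab : ∀ γ ∈ Γ, ∀ x ∈ M, ((γ : _ →ₗ[ℚ] _).baseChange ℂ) x ∈ M := by
    intro γ hγ x hx
    have hc : (γ : _ →ₗ[ℚ] _) ∘ₗ A = A ∘ₗ (γ : _ →ₗ[ℚ] _) := LinearMap.ext fun y ↦ hAΓ γ hγ y
    have hcomm : ∀ y, ((γ : _ →ₗ[ℚ] _).baseChange ℂ) (A.baseChange ℂ y) =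
        A.baseChange ℂ (((γ : _ →ₗ[ℚ] _).baseChange ℂ) y) := fun y ↦ by
      have := congrArg (fun f : bettiCohomology Xs 2 →ₗ[ℚ] bettiCohomology Xs 2 ↦ f.baseChange ℂ y) hc
      simpa only [LinearMap.baseChange_comp, LinearMap.comp_apply] using this
    rw [hM_def] at hx ⊢
    exact apply_mem_eigenspace_of_comm hcomm hx
  -- `β_s M` is a sub-variation (the `i`-eigenspace of the flat field `τ_t^*`)
  let τC : ∀ t : (Set.univ : Set (ComplexPoints S)),
      complexBetti (fiberOver π t.1) 2 →ₗ[ℂ] complexBetti (fiberOver π t.1) 2 := fun t ↦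
    (complexBetti.map (fiberOverEnd π τ hτπ t.1) 2).hom
  have hτC : ∀ (t : (Set.univ : Set (ComplexPoints S))) (y : complexBetti (fiberOver π t.1) 2),
      τC t y = complexBetti.map (fiberOverEnd π τ hτπ t.1) 2 y := fun t y ↦ rfl
  have hflat : ∀ (t : (Set.univ : Set (ComplexPoints S)))
      (γ : Path.Homotopic.Quotient (⟨s, Set.mem_univ s⟩ : (Set.univ : Set (ComplexPoints S))) t)
      (x : complexBetti (fiberOver π s) 2),
      transportFun π 2 hU γ (τC ⟨s, Set.mem_univ s⟩ x) = τC t (transportFun π 2 hU γ x) :=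
    fun t γ x ↦ transportFun_map_fiberHom π 2 hU τ hτπ (fun t ↦ fiberOverEnd π τ hτπ t)
      (fun t ↦ fiberOverEnd_comp_fiberι π τ hτπ t) γ x
  have htype : ∀ (t : (Set.univ : Set (ComplexPoints S))) (p q : ℕ) (x : complexBetti (fiberOver π t.1) 2),
      IsOfHodgeType 2 (fiberOver π t.1) 2 p q x → IsOfHodgeType 2 (fiberOver π t.1) 2 p q (τC t x) :=
    fun t p q x hx ↦ IsOfHodgeType.map_endomorphism (hπ.isSmoothProjective t.1) (fiberOverEnd π τ hτπ t.1) hx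
  have hmap : M.map e.toLinearMap = Module.End.eigenspace (τC ⟨s, Set.mem_univ s⟩) Complex.I := by
    ext y
    constructor
    · rintro ⟨x, hx, rfl⟩
      rw [SetLike.mem_coe, Module.End.mem_eigenspace_iff] at hx
      rw [Module.End.mem_eigenspace_iff, LinearEquiv.coe_coe, hτC, ofRatClassBaseChangeEquiv_apply,
        ← ofRatClassBaseChange_baseChange_pull, hx, map_smul]
    · intro hy
      rw [Module.End.mem_eigenspace_iff] at hy
      refine ⟨e.symm y, ?_, e.apply_symm_apply y⟩
      rw [SetLike.mem_coe, Module.End.mem_eigenspace_iff]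
      apply e.injective
      rw [map_smul, e.apply_symm_apply, ofRatClassBaseChangeEquiv_apply, ofRatClassBaseChange_baseChange_pull,
        ← ofRatClassBaseChangeEquiv_apply hXs, e.apply_symm_apply]
      exact hy
  have hMv : IsSubvariation π 2 hU 2 ⟨s, Set.mem_univ s⟩ (M.map e.toLinearMap) := by
    rw [hmap]
    exact isSubvariation_eigenspace (fun t ↦ hπ.isSmoothProjective t.1) τC hflat htype Complex.I
  have hM0 : M ≠ ⊥ := fun h ↦ by
    rw [h, finrank_bot] at h6
    exact absurd h6 (by norm_num)
  -- irreducibility of `M` under every finite-index `Γ'` from (STAB)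
  have hirr : ∀ Γ' : Subgroup (bettiCohomology Xs 2 ≃ₗ[ℚ] bettiCohomology Xs 2), Γ' ≤ Γ →
      (Γ'.subgroupOf Γ).FiniteIndex → ∀ F : Submodule ℂ (TensorProduct ℚ ℂ (bettiCohomology Xs 2)),
        F ≤ M → (∀ γ ∈ Γ', ∀ x ∈ F, ((γ : _ →ₗ[ℚ] _).baseChange ℂ) x ∈ F) → F = ⊥ ∨ F = M :=
    fun Γ' hΓ' hfi F hF hFs ↦
      eq_bot_or_eq_of_stable_of_stabilizer_scalar hDelB π 2 2 d hπ hS hU Am hAm ⟨s, Set.mem_univ s⟩ hMv hM0 2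
        hSTAB hfi (fun γ hγ x hx ↦ hMstab γ (hΓ' hγ) x hx) F hF hFs
  exact transcendentalQuaternionicPart_at_member_of_irreducible π hπ hU τ hτπ s hA4 ho ho' h6 hirr

/-- **The S4 body at EVERY member of ONE family from the stabiliser condition at ONE member** (family-level
form for the ∃-packaged stub S9 of skeleton v9, uniform in `e`): under the S6 clause binders and `hU`, given at
one member `b` the counts (o)_b, (o′)_b, `6 ≤ dim M_b` and (STAB)_b for `M_b = ker(τ_b^* ⊗ ℂ − i)`, the S4-v6
body holds at every `s` (`…_at_member_of_stabilizer_scalar` at `b`, `A_b⁴ = 1` from the deck relations, then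
19716-p2's (B′) `transcendentalQuaternionicPart_forall_of_member_at`). [cite: Deligne1987, §1.12–1.13 (p. 10–11)]
[cite: VoisinHodgeII2003, §3.1.2] -/
theorem transcendentalQuaternionicPart_forall_of_stabilizer_scalar
    (hDelB : deligne1987_monodromy_directSum_irreducible_subvariations) :
    open Literature.AlgebraicGeometry.Motives Literature.AlgebraicGeometry.HodgeTheory Literature.AlgebraicGeometry.HodgeTheory.BettiUniverse Literature.AlgebraicGeometry.HodgeTheory.Q8Family Literature.AlgebraicGeometry.RelativeSpec Literature.AlgebraicGeometry.RelativeSpec.ActionOver CategoryTheory CategoryTheory.Limits MonoidalCategory CartesianMonoidalCategory AlgebraicGeometry in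
    ∀ ⦃e : ℕ⦄, Even e → 4 ≤ e → ∀ (W : (Spec (.of (ParamRing e))).Opens) (𝒳 : SchemeOver ℂ) (π : 𝒳 ⟶ base W) (τ j : 𝒳 ⟶ 𝒳) (ι : (deckChart (fun i => (MvPolynomial.X i : ParamRing e)) ⊗ Over.mk W.ι).left ⟶ 𝒳.left), Nonempty (ComplexPoints (base W)) → ∀ (hπ : IsSmoothProjectiveFamily π 2), IsQuasiProjectiveOver 𝒳 → IsQuasiProjectiveOver (base W) → AlgebraicGeometry.SmoothOfRelativeDimension (Fintype.card (CIdx e)) (base W).hom → ∀ (hτπ : τ ≫ π = π) (hjπ : j ≫ π = π), τ ≫ τ ≫ τ ≫ τ = 𝟙 𝒳 → j ≫ j = τ ≫ τ → τ ≫ j ≫ τ = j → IsOpenImmersion ι → ι ≫ π.left = (snd (deckChart (fun i => (MvPolynomial.X i : ParamRing e))) (Over.mk W.ι)).left → ((Over.isoMk ((deckAction (fun i => (MvPolynomial.X i : ParamRing e))).aut (QuaternionGroup.a 1)) ((deckAction (fun i => (MvPolynomial.X i : ParamRing e))).aut_comp (QuaternionGroup.a 1))).hom ▷ Over.mk W.ι).left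 ≫ ι = ι ≫ τ.left → ((Over.isoMk ((deckAction (fun i => (MvPolynomial.X i : ParamRing e))).aut (QuaternionGroup.xa 0)) ((deckAction (fun i => (MvPolynomial.X i : ParamRing e))).aut_comp (QuaternionGroup.xa 0))).hom ▷ Over.mk W.ι).left ≫ ι = ι ≫ j.left → Function.Surjective (snd (deckChart (fun i => (MvPolynomial.X i : ParamRing e))) (Over.mk W.ι)).left → ∀ (hU : IsCohomologicallyLocallyTrivialOn π Set.univ) (b : ComplexPoints (base W)), (let Xb := fiberOver π b; let hXb : IsSmoothProjective 2 Xb := hπ.isSmoothProjective b; let Ab : bettiCohomology Xb 2 →ₗ[ℚ] bettiCohomology Xb 2 := pull (fiberOverEnd π τ hτπ b) 2; let Mb : Submodule ℂ (TensorProduct ℚ ℂ (bettiCohomology Xb 2)) := Module.End.eigenspace (Ab.baseChange ℂ) Complex.I; Module.finrank ℂ ↥(Module.End.eigenspace ((Ab ^ 2).baseChange ℂ) 1 ⊓ (hodge exists_isReal_hodgeModel_holds hXb 2).piece 2 0) = 0 → 0 < Module.finrank ℂ ↥(Module.End.eigenspace ((Ab ^ 2).baseChange ℂ) (-1) ⊓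 (hodge exists_isReal_hodgeModel_holds hXb 2).piece 2 0) → 6 ≤ Module.finrank ℂ ↥Mb → (∀ φ : (TensorProduct ℚ ℂ (bettiCohomology Xb 2)) →ₗ[ℂ] (TensorProduct ℚ ℂ (bettiCohomology Xb 2)), (∀ x ∈ Mb, φ x ∈ Mb) → (∀ (t : (Set.univ : Set (ComplexPoints (base W)))) (γ : Path.Homotopic.Quotient (⟨b, Set.mem_univ b⟩ : (Set.univ : Set (ComplexPoints (base W)))) t) (T : bettiCohomology Xb 2 ≃ₗ[ℚ] bettiCohomology (fiberOver π t.1) 2), (∀ v, ofRatClass _ 2 (T v) = transportFun π 2 hU γ (ofRatClass _ 2 v)) → ∀ x ∈ Mb ⊓ ((hodge exists_isReal_hodgeModel_holds (hπ.isSmoothProjective t.1) 2).comapEquiv T).F 2, φ x ∈ ((hodge exists_isReal_hodgeModel_holds (hπ.isSmoothProjective t.1) 2).comapEquiv T).F 2) → ∃ c : ℂ, ∀ x ∈ Mb, φ x = c • x) → ∀ (s : ComplexPoints (base W)), let Xs := fiberOver π s; let hXs : IsSmoothProjective 2 Xs := hπ.isSmoothProjective s; let A : bettiCohomology Xs 2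 →ₗ[ℚ] bettiCohomology Xs 2 := pull (fiberOverEnd π τ hτπ s) 2; let Qf : LinearMap.BilinForm ℚ (bettiCohomology Xs 2) := LinearMap.compr₂ (cup Xs 2 2) (tr hXs (2 + 2)); let Γ := ratMonodromyGroup π 2 hU ⟨s, Set.mem_univ s⟩; let N : Submodule ℚ (bettiCohomology Xs 2) := Submodule.span ℚ {x | ∃ Γ' : Subgroup (bettiCohomology Xs 2 ≃ₗ[ℚ] bettiCohomology Xs 2), Γ' ≤ Γ ∧ (Γ'.subgroupOf Γ).FiniteIndex ∧ ∀ γ ∈ Γ', γ x = x}; let Mv : Submodule ℚ (bettiCohomology Xs 2) := Module.End.eigenspace (A ^ 2) (-1) ⊓ Qf.orthogonal N; let Miv : Submodule ℂ (TensorProduct ℚ ℂ (bettiCohomology Xs 2)) := Mv.baseChange ℂ ⊓ Module.End.eigenspace (A.baseChange ℂ) Complex.I; Module.finrank ℂ ↥(Module.End.eigenspace ((A ^ 2).baseChange ℂ) 1 ⊓ (hodge exists_isReal_hodgeModel_holds hXs 2).piece 2 0) = 0 ∧ 0 < Module.finrank ℂ ↥(Module.End.eigenspace ((A ^ 2).baseChange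 ℂ) (-1) ⊓ (hodge exists_isReal_hodgeModel_holds hXs 2).piece 2 0) ∧ (N.baseChange ℂ ⊓ (hodge exists_isReal_hodgeModel_holds hXs 2).piece 2 0 = ⊥) ∧ 6 ≤ Module.finrank ℂ Miv ∧ (∀ Γ' : Subgroup (bettiCohomology Xs 2 ≃ₗ[ℚ] bettiCohomology Xs 2), Γ' ≤ Γ → (Γ'.subgroupOf Γ).FiniteIndex → ∀ F : Submodule ℂ (TensorProduct ℚ ℂ (bettiCohomology Xs 2)), F ≤ Miv → (∀ γ ∈ Γ', ∀ x ∈ F, (γ.toLinearMap.baseChange ℂ) x ∈ F) → F = ⊥ ∨ F = Miv) ∧ N ≤ Module.End.eigenspace (A ^ 2) 1) := by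
  intro e he h4 W 𝒳 π τ j ι hne hπ hqp hqpW hsm hτπ hjπ hτ4 hj2 hτjτ hιo hιπ hιτ hιj hsurj hU b Xb hXb Ab Mb hob
    hob' h6 hSTAB s
  haveI := hsm
  obtain ⟨r1, -, -⟩ := quaternionRelations_pull_fiberOverEnd π hτπ hjπ hτ4 hj2 hτjτ b 2
  obtain ⟨-, -, -, hii, hiii, hiv⟩ :=
    transcendentalQuaternionicPart_at_member_of_stabilizer_scalar hDelB π (Fintype.card (CIdx e)) hπ hqpW hU τ hτπ
      b r1 hob hob' h6 hSTAB
  exact Q8SymplecticPowersTranscendentalPartOfMember.transcendentalQuaternionicPart_forall_of_member_at he h4 W 𝒳 π τ j ι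
    hne hπ hqp hqpW hsm hτπ hjπ hτ4 hj2 hτjτ hιo hιπ hιτ hιj hsurj hU b ⟨hob, hob'⟩ ⟨hii, hiii, hiv⟩ s

/-- **The six S4 conjuncts at a member from a JET-STABILISER certificate** (uniform in `e`; verbatim S4
`let`-currency): FACT B → `A⁴ = 1` → (o)_s → (o′)_s → `6 ≤ dim M` → data (chart `ψ`, `W₀`, vectors `ω z i`,
functionals `η z l`, order `r`) with `ω (ψ t) i ∈ M ∩ F²(X_t)` and `η (ψ t) l` killing `M ∩ F²(X_t)` at the nearby
members → the finite jet-stabiliser statement → `(o) ∧ (o′) ∧ (i) ∧ (ii) ∧ ((iii)) ∧ (iv)`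
(`stabilizer_scalar_of_jetStabilizer` then `…_at_member_of_stabilizer_scalar`). This is the typed shape of the
cell's (C37) «STAB-JET» certificate for the degrees `e ≥ 6`. [cite: Deligne1987, §1.12–1.13 (p. 10–11)]
[cite: VoisinHodgeI2002, §10.2.3] -/
theorem transcendentalQuaternionicPart_at_member_of_jetStabilizer
    (hDelB : deligne1987_monodromy_directSum_irreducible_subvariations)
    (π : 𝒳 ⟶ S) (d : ℕ) (hπ : IsSmoothProjectiveFamily π 2) (hS : IsQuasiProjectiveOver S)
    [AlgebraicGeometry.SmoothOfRelativeDimension d S.hom]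
    (hU : IsCohomologicallyLocallyTrivialOn π (Set.univ : Set (ComplexPoints S)))
    (τ : 𝒳 ⟶ 𝒳) (hτπ : τ ≫ π = π) (s : ComplexPoints S)
    (ψ : OpenPartialHomeomorph (Set.univ : Set (ComplexPoints S)) (Fin d → ℂ))
    (W₀ : Set (Set.univ : Set (ComplexPoints S))) (hW₀o : IsOpen W₀)
    (hsW₀ : (⟨s, Set.mem_univ s⟩ : (Set.univ : Set (ComplexPoints S))) ∈ W₀) (hW₀ψ : W₀ ⊆ ψ.source)
    {ι ι' : Type*} (ω : (Fin d → ℂ) → ι → ℂ ⊗[ℚ] bettiCohomology (fiberOver π s) 2)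
    (η : (Fin d → ℂ) → ι' → Module.Dual ℂ (ℂ ⊗[ℚ] bettiCohomology (fiberOver π s) 2)) (r : ℕ) :
    let Xs := fiberOver π s
    let hXs : IsSmoothProjective 2 Xs := hπ.isSmoothProjective s
    let A : bettiCohomology Xs 2 →ₗ[ℚ] bettiCohomology Xs 2 := pull (fiberOverEnd π τ hτπ s) 2
    let Qf : LinearMap.BilinForm ℚ (bettiCohomology Xs 2) := LinearMap.compr₂ (cup Xs 2 2) (tr hXs (2 + 2))
    let Γ := ratMonodromyGroup π 2 hU ⟨s, Set.mem_univ s⟩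
    let N : Submodule ℚ (bettiCohomology Xs 2) := Submodule.span ℚ {x | ∃ Γ' : Subgroup
      (bettiCohomology Xs 2 ≃ₗ[ℚ] bettiCohomology Xs 2), Γ' ≤ Γ ∧ (Γ'.subgroupOf Γ).FiniteIndex ∧
        ∀ γ ∈ Γ', γ x = x}
    let Mv : Submodule ℚ (bettiCohomology Xs 2) := Module.End.eigenspace (A ^ 2) (-1) ⊓ Qf.orthogonal N
    let Miv : Submodule ℂ (TensorProduct ℚ ℂ (bettiCohomology Xs 2)) :=
      Mv.baseChange ℂ ⊓ Module.End.eigenspace (A.baseChange ℂ) Complex.I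
    let M : Submodule ℂ (TensorProduct ℚ ℂ (bettiCohomology Xs 2)) :=
      Module.End.eigenspace (A.baseChange ℂ) Complex.I
    A ^ 4 = 1 →
    Module.finrank ℂ ↥(Module.End.eigenspace ((A ^ 2).baseChange ℂ) 1 ⊓
      (hodge exists_isReal_hodgeModel_holds hXs 2).piece 2 0) = 0 →
    0 < Module.finrank ℂ ↥(Module.End.eigenspace ((A ^ 2).baseChange ℂ) (-1) ⊓
      (hodge exists_isReal_hodgeModel_holds hXs 2).piece 2 0) →
    6 ≤ Module.finrank ℂ ↥M →
    (∀ t ∈ W₀, ∀ (ε : Path (⟨s, Set.mem_univ s⟩ : (Set.univ : Set (ComplexPoints S))) t), (∀ r', ε r' ∈ W₀) →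
      ∀ (T : bettiCohomology Xs 2 ≃ₗ[ℚ] bettiCohomology (fiberOver π t.1) 2),
        (∀ v, ofRatClass _ 2 (T v) = transportFun π 2 hU ⟦ε⟧ (ofRatClass _ 2 v)) →
        ∀ i, ω (ψ t) i ∈ M ⊓ ((hodge exists_isReal_hodgeModel_holds (hπ.isSmoothProjective t.1) 2).comapEquiv T).F 2) →
    (∀ t ∈ W₀, ∀ (ε : Path (⟨s, Set.mem_univ s⟩ : (Set.univ : Set (ComplexPoints S))) t), (∀ r', ε r' ∈ W₀) →
      ∀ (T : bettiCohomology Xs 2 ≃ₗ[ℚ] bettiCohomology (fiberOver π t.1) 2),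
        (∀ v, ofRatClass _ 2 (T v) = transportFun π 2 hU ⟦ε⟧ (ofRatClass _ 2 v)) →
        ∀ l, ∀ x ∈ M ⊓ ((hodge exists_isReal_hodgeModel_holds (hπ.isSmoothProjective t.1) 2).comapEquiv T).F 2,
          η (ψ t) l x = 0) →
    (∀ φ : (TensorProduct ℚ ℂ (bettiCohomology Xs 2)) →ₗ[ℂ] (TensorProduct ℚ ℂ (bettiCohomology Xs 2)),
      (∀ x ∈ M, φ x ∈ M) →
      (∀ i l, ∀ m ≤ r, iteratedFDeriv ℂ m (fun z ↦ η z l (φ (ω z i))) (ψ ⟨s, Set.mem_univ s⟩) = 0) →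
      ∃ c : ℂ, ∀ x ∈ M, φ x = c • x) →
    Module.finrank ℂ ↥(Module.End.eigenspace ((A ^ 2).baseChange ℂ) 1 ⊓
        (hodge exists_isReal_hodgeModel_holds hXs 2).piece 2 0) = 0 ∧
      0 < Module.finrank ℂ ↥(Module.End.eigenspace ((A ^ 2).baseChange ℂ) (-1) ⊓
        (hodge exists_isReal_hodgeModel_holds hXs 2).piece 2 0) ∧
      (N.baseChange ℂ ⊓ (hodge exists_isReal_hodgeModel_holds hXs 2).piece 2 0 = ⊥) ∧
      6 ≤ Module.finrank ℂ ↥Miv ∧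
      (∀ Γ' : Subgroup (bettiCohomology Xs 2 ≃ₗ[ℚ] bettiCohomology Xs 2), Γ' ≤ Γ →
        (Γ'.subgroupOf Γ).FiniteIndex → ∀ F : Submodule ℂ (TensorProduct ℚ ℂ (bettiCohomology Xs 2)),
          F ≤ Miv → (∀ γ ∈ Γ', ∀ x ∈ F, (γ.toLinearMap.baseChange ℂ) x ∈ F) → F = ⊥ ∨ F = Miv) ∧
      N ≤ Module.End.eigenspace (A ^ 2) 1 := by
  intro Xs hXs A Qf Γ N Mv Miv M hA4 ho ho' h6 hω hη hjet
  let Am : ∀ t : ComplexPoints S, HodgeModel 2 (fiberOver π t) := fun t ↦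
    realHodgeModel exists_isReal_hodgeModel_holds (hπ.isSmoothProjective t)
  have hAm : ∀ t, (Am t).IsHodgeSymmetric := fun t ↦
    realHodgeModel_isHodgeSymmetric exists_isReal_hodgeModel_holds (hπ.isSmoothProjective t)
  have hSTAB := stabilizer_scalar_of_jetStabilizer π 2 2 d hπ hS hU Am hAm ⟨s, Set.mem_univ s⟩ M 2 ψ W₀ hW₀o
    hsW₀ hW₀ψ ω η hω hη r hjet
  exact transcendentalQuaternionicPart_at_member_of_stabilizer_scalar hDelB π d hπ hS hU τ hτπ s hA4 ho ho' h6 hSTAB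

/-- **The S4 body at EVERY member of ONE family from a jet-stabiliser certificate at ONE member** (family-level
form for the ∃-packaged stub `stub_certifiedDeckFamilyQge6` of skeleton v10, uniform in `e`; composition of
`…_at_member_of_jetStabilizer` at `b`, `A_b⁴ = 1` from the deck relations, and 19716-p2's (B′)
`transcendentalQuaternionicPart_forall_of_member_at`). [cite: Deligne1987, §1.12–1.13 (p. 10–11)] [cite: VoisinHodgeII2003, §3.1.2] -/
theorem transcendentalQuaternionicPart_forall_of_jetStabilizer
    (hDelB : deligne1987_monodromy_directSum_irreducible_subvariations) :
    open Literature.AlgebraicGeometry.Motives Literature.AlgebraicGeometry.HodgeTheory Literature.AlgebraicGeometry.HodgeTheory.BettiUniverse Literature.AlgebraicGeometry.HodgeTheory.Q8Family Literature.AlgebraicGeometry.RelativeSpec Literature.AlgebraicGeometry.RelativeSpec.ActionOver CategoryTheory CategoryTheory.Limits MonoidalCategory CartesianMonoidalCategory AlgebraicGeometry in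
    ∀ ⦃e : ℕ⦄, Even e → 4 ≤ e → ∀ (W : (Spec (.of (ParamRing e))).Opens) (𝒳 : SchemeOver ℂ) (π : 𝒳 ⟶ base W) (τ j : 𝒳 ⟶ 𝒳) (ι : (deckChart (fun i => (MvPolynomial.X i : ParamRing e)) ⊗ Over.mk W.ι).left ⟶ 𝒳.left), Nonempty (ComplexPoints (base W)) → ∀ (hπ : IsSmoothProjectiveFamily π 2), IsQuasiProjectiveOver 𝒳 → IsQuasiProjectiveOver (base W) → AlgebraicGeometry.SmoothOfRelativeDimension (Fintype.card (CIdx e)) (base W).hom → ∀ (hτπ : τ ≫ π = π) (hjπ : j ≫ π = π), τ ≫ τ ≫ τ ≫ τ = 𝟙 𝒳 → j ≫ j = τ ≫ τ → τ ≫ j ≫ τ = j → IsOpenImmersion ι → ι ≫ π.left = (snd (deckChart (fun i => (MvPolynomial.X i : ParamRing e))) (Over.mk W.ι)).left → ((Over.isoMk ((deckAction (fun i => (MvPolynomial.X i : ParamRing e))).aut (QuaternionGroup.a 1)) ((deckAction (fun i => (MvPolynomial.X i : ParamRing e))).aut_comp (QuaternionGroup.a 1))).hom ▷ Over.mk W.ι).left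 ≫ ι = ι ≫ τ.left → ((Over.isoMk ((deckAction (fun i => (MvPolynomial.X i : ParamRing e))).aut (QuaternionGroup.xa 0)) ((deckAction (fun i => (MvPolynomial.X i : ParamRing e))).aut_comp (QuaternionGroup.xa 0))).hom ▷ Over.mk W.ι).left ≫ ι = ι ≫ j.left → Function.Surjective (snd (deckChart (fun i => (MvPolynomial.X i : ParamRing e))) (Over.mk W.ι)).left → ∀ (hU : IsCohomologicallyLocallyTrivialOn π Set.univ) (b : ComplexPoints (base W)) (ψ : OpenPartialHomeomorph (Set.univ : Set (ComplexPoints (base W))) (Fin (Fintype.card (CIdx e)) → ℂ)) (W₀ : Set (Set.univ : Set (ComplexPoints (base W)))) {ι ι' : Type} (ω : (Fin (Fintype.card (CIdx e)) → ℂ) → ι → TensorProduct ℚ ℂ (bettiCohomology (fiberOver π b) 2)) (η : (Fin (Fintype.card (CIdx e)) → ℂ) → ι' → Module.Dual ℂ (TensorProduct ℚ ℂ (bettiCohomology (fiberOver π b) 2))) (r : ℕ), IsOpen W₀ → (⟨b, Set.mem_univ b⟩ : (Set.univ : Set (ComplexPoints (base W)))) ∈ W₀ → W₀ ⊆ ψ.source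 → (let Xb := fiberOver π b; let hXb : IsSmoothProjective 2 Xb := hπ.isSmoothProjective b; let Ab : bettiCohomology Xb 2 →ₗ[ℚ] bettiCohomology Xb 2 := pull (fiberOverEnd π τ hτπ b) 2; let Mb : Submodule ℂ (TensorProduct ℚ ℂ (bettiCohomology Xb 2)) := Module.End.eigenspace (Ab.baseChange ℂ) Complex.I; Module.finrank ℂ ↥(Module.End.eigenspace ((Ab ^ 2).baseChange ℂ) 1 ⊓ (hodge exists_isReal_hodgeModel_holds hXb 2).piece 2 0) = 0 → 0 < Module.finrank ℂ ↥(Module.End.eigenspace ((Ab ^ 2).baseChange ℂ) (-1) ⊓ (hodge exists_isReal_hodgeModel_holds hXb 2).piece 2 0) → 6 ≤ Module.finrank ℂ ↥Mb → (∀ t ∈ W₀, ∀ (ε : Path (⟨b, Set.mem_univ b⟩ : (Set.univ : Set (ComplexPoints (base W)))) t), (∀ r', ε r' ∈ W₀) → ∀ (T : bettiCohomology Xb 2 ≃ₗ[ℚ] bettiCohomology (fiberOver π t.1) 2), (∀ v, ofRatClass _ 2 (T v) = transportFun π 2 hU ⟦ε⟧ (ofRatClass _ 2 v)) → ∀ i,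 ω (ψ t) i ∈ Mb ⊓ ((hodge exists_isReal_hodgeModel_holds (hπ.isSmoothProjective t.1) 2).comapEquiv T).F 2) → (∀ t ∈ W₀, ∀ (ε : Path (⟨b, Set.mem_univ b⟩ : (Set.univ : Set (ComplexPoints (base W)))) t), (∀ r', ε r' ∈ W₀) → ∀ (T : bettiCohomology Xb 2 ≃ₗ[ℚ] bettiCohomology (fiberOver π t.1) 2), (∀ v, ofRatClass _ 2 (T v) = transportFun π 2 hU ⟦ε⟧ (ofRatClass _ 2 v)) → ∀ l, ∀ x ∈ Mb ⊓ ((hodge exists_isReal_hodgeModel_holds (hπ.isSmoothProjective t.1) 2).comapEquiv T).F 2, η (ψ t) l x = 0) → (∀ φ : (TensorProduct ℚ ℂ (bettiCohomology Xb 2)) →ₗ[ℂ] (TensorProduct ℚ ℂ (bettiCohomology Xb 2)), (∀ x ∈ Mb, φ x ∈ Mb) → (∀ i l, ∀ m ≤ r, iteratedFDeriv ℂ m (fun z ↦ η z l (φ (ω z i))) (ψ ⟨b, Set.mem_univ b⟩) = 0) → ∃ c : ℂ, ∀ x ∈ Mb, φ x = c • x) → ∀ (s : ComplexPoints (base W)),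 let Xs := fiberOver π s; let hXs : IsSmoothProjective 2 Xs := hπ.isSmoothProjective s; let A : bettiCohomology Xs 2 →ₗ[ℚ] bettiCohomology Xs 2 := pull (fiberOverEnd π τ hτπ s) 2; let Qf : LinearMap.BilinForm ℚ (bettiCohomology Xs 2) := LinearMap.compr₂ (cup Xs 2 2) (tr hXs (2 + 2)); let Γ := ratMonodromyGroup π 2 hU ⟨s, Set.mem_univ s⟩; let N : Submodule ℚ (bettiCohomology Xs 2) := Submodule.span ℚ {x | ∃ Γ' : Subgroup (bettiCohomology Xs 2 ≃ₗ[ℚ] bettiCohomology Xs 2), Γ' ≤ Γ ∧ (Γ'.subgroupOf Γ).FiniteIndex ∧ ∀ γ ∈ Γ', γ x = x}; let Mv : Submodule ℚ (bettiCohomology Xs 2) := Module.End.eigenspace (A ^ 2) (-1) ⊓ Qf.orthogonal N; let Miv : Submodule ℂ (TensorProduct ℚ ℂ (bettiCohomology Xs 2)) := Mv.baseChange ℂ ⊓ Module.End.eigenspace (A.baseChange ℂ) Complex.I; Module.finrank ℂ ↥(Module.End.eigenspace ((A ^ 2).baseChange ℂ) 1 ⊓ (hodge exists_isReal_hodgeModel_holds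 hXs 2).piece 2 0) = 0 ∧ 0 < Module.finrank ℂ ↥(Module.End.eigenspace ((A ^ 2).baseChange ℂ) (-1) ⊓ (hodge exists_isReal_hodgeModel_holds hXs 2).piece 2 0) ∧ (N.baseChange ℂ ⊓ (hodge exists_isReal_hodgeModel_holds hXs 2).piece 2 0 = ⊥) ∧ 6 ≤ Module.finrank ℂ Miv ∧ (∀ Γ' : Subgroup (bettiCohomology Xs 2 ≃ₗ[ℚ] bettiCohomology Xs 2), Γ' ≤ Γ → (Γ'.subgroupOf Γ).FiniteIndex → ∀ F : Submodule ℂ (TensorProduct ℚ ℂ (bettiCohomology Xs 2)), F ≤ Miv → (∀ γ ∈ Γ', ∀ x ∈ F, (γ.toLinearMap.baseChange ℂ) x ∈ F) → F = ⊥ ∨ F = Miv) ∧ N ≤ Module.End.eigenspace (A ^ 2) 1) := by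
  intro e he h4 W 𝒳 π τ j ι hne hπ hqp hqpW hsm hτπ hjπ hτ4 hj2 hτjτ hιo hιπ hιτ hιj hsurj hU b ψ W₀ ι₁ ι₂ ω η r hW₀o
    hbW₀ hW₀ψ Xb hXb Ab Mb hob hob' h6 hω hη hjet s
  haveI := hsm
  obtain ⟨r1, -, -⟩ := quaternionRelations_pull_fiberOverEnd π hτπ hjπ hτ4 hj2 hτjτ b 2
  obtain ⟨-, -, -, hii, hiii, hiv⟩ :=
    transcendentalQuaternionicPart_at_member_of_jetStabilizer hDelB π (Fintype.card (CIdx e)) hπ hqpW hU τ hτπ b ψ W₀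
      hW₀o hbW₀ hW₀ψ ω η r r1 hob hob' h6 hω hη hjet
  exact Q8SymplecticPowersTranscendentalPartOfMember.transcendentalQuaternionicPart_forall_of_member_at he h4 W 𝒳 π τ j ι
    hne hπ hqp hqpW hsm hτπ hjπ hτ4 hj2 hτjτ hιo hιπ hιτ hιj hsurj hU b ⟨hob, hob'⟩ ⟨hii, hiii, hiv⟩ s

end Summit.HodgeConjecture.HodgeConjecture.Theorems.Q8SymplecticPowersTranscendentalIrreducibleOfStabilizer

end
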